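import Summits.MatrixMultiplication.OmegaCensus.SmallFormats.InvertiblePointLineColumnsPlusOne
import HarnessLib

/-!
# ω-census family (a): the TWO-COLUMN CLAUSE at a saturated invertible point (abstract form of the `LC+1` law)

Cell `pub-omega` (unit `pub-omega-tensor`, gen 34), topic `Summits/MatrixMultiplication/OmegaCensus` (sub-folder
`SmallFormats`). Framing (verbatim): lottery ticket; floor = certified bounds/negative ranges. HONEST FRAMING: an elementary
structural lemma over an arbitrary field; it is the MAIN argument of tensor g27's `not_lineColumnShape_succ`
(`InvertiblePointLineColumnsPlusOne`, p541133) with the two free unit columns replaced by two arbitrary linearly independent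
row vectors `ρ₁, ρ₂ ∈ kⁿ` and the free-column space by the 'two-column space' `E = k² ⊗ ρ₁ + k² ⊗ ρ₂`.

**Theorem (`two_column_clause`).** At a saturated `X₀ = 1` (`|O| = 2n`), let `K₀` be the common kernel of the forms `g_t`,
`t ∉ O`. Then `K₀ ⊓ E` has codimension at least `2` in `E`: `dim (K₀ ⊓ E) + 2 ≤ dim E` is needed, i.e. it is IMPOSSIBLE that
`dim E ≤ dim (K₀ ⊓ E) + 1`. Proof verbatim from the parent file: (H) any two vectors of `E` combine non-trivially into
`K₀`; so for each of the directions `ρ₁, ρ₂, ρ₁ + ρ₂` some `x ≠ 0` has `x ⊗ ρ ∈ K₀`; (A) no column plane `k² ⊗ v` in `K₀`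
(`no_columnPlane_of_forall_g_eq_zero`); (B)/(C) the dichotomy `g_vanish_or_f_vanish` and `not_f_vanish_two_annihilators`;
pairwise independent `x`'s make every `g_s` kill `e₀ ⊗ ρ₁`, so `ρ₁ = 0`. Used by `InvertiblePointDeltaLawTwo` (two `L₁ᵀ`
blocks cost two dimensions: the δ-law improves to `3r ≥ 10n + 2`). Not a rank bound by itself; nothing on `ω`.
-/

namespace Summit.MatrixMultiplication.OmegaCensus.SmallFormats

open Module Matrix Literature.Computability.AlgebraicComplexity

namespace DeltaLaw

variable {k : Type*} [Field k] {n : ℕ} {ι : Type*} [Fintype ι] [DecidableEq ι]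

/-- **The two-column clause.** At a saturated `X₀ = 1`, for linearly independent `ρ₁, ρ₂ ∈ kⁿ` and the two-column space
`E` spanned by the `e_i ⊗ ρ_l`, the common kernel `K₀` of the vanishing terms' forms cannot meet `E` in codimension `≤ 1`. -/
theorem two_column_clause (β : BilinComp (mulBilin k 2 2 n) ι) (O : Finset ι)
    (hO : ∀ i, i ∉ O → β.f i 1 = 0) (hO' : ∀ i ∈ O, β.f i 1 ≠ 0) (hcard : O.card = 2 * n)
    {ρ₁ ρ₂ : Fin n → k} (hind : ∀ a c : k, a • ρ₁ + c • ρ₂ = 0 → a = 0 ∧ c = 0)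
    (K₀ : Submodule k (Matrix (Fin 2) (Fin n) k)) (hK₀ : ∀ W ∈ K₀, ∀ t, t ∉ O → β.g t W = 0)
    (E : Submodule k (Matrix (Fin 2) (Fin n) k))
    (hE : ∀ (x : Fin 2 → k) (a c : k), vecMulVec x (a • ρ₁ + c • ρ₂) ∈ E)
    (hcodim : finrank k E ≤ finrank k ↥(K₀ ⊓ E) + 1) : False := by
  classical
  set K' : Submodule k (Matrix (Fin 2) (Fin n) k) := K₀ ⊓ E with hK'
  have hle : K' ≤ E := inf_le_right
  have hK'K : ∀ W ∈ K', W ∈ K₀ := fun W hW => hW.1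
  -- free directions `vv a c = a ρ₁ + c ρ₂`
  let vv : k → k → (Fin n → k) := fun a c => a • ρ₁ + c • ρ₂
  have hvne : ∀ a c, (a ≠ 0 ∨ c ≠ 0) → vv a c ≠ 0 := by
    intro a c hac h
    obtain ⟨ha, hc⟩ := hind a c h
    rcases hac with h' | h'
    exacts [h' ha, h' hc]
  have hv3 : vv 1 1 = vv 1 0 + vv 0 1 := by simp [vv]
  have hvlin : ∀ a c, vv a c = a • vv 1 0 + c • vv 0 1 := fun a c => by simp [vv]
  have hvM : ∀ (x : Fin 2 → k) (a c : k), vecMulVec x (vv a c) ∈ E := fun x a c => hE x a c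
  have hρ₁ : ρ₁ ≠ 0 := by
    intro h
    have := (hind 1 0 (by rw [h, smul_zero, zero_smul, add_zero])).1
    exact one_ne_zero this
  -- (H): for every free direction some `x ≠ 0` has `x ⊗ v ∈ K₀`
  have hH : ∀ a c, ∃ x : Fin 2 → k, x ≠ 0 ∧ vecMulVec x (vv a c) ∈ K₀ := by
    intro a c
    obtain ⟨p, q, hpq, hmem⟩ := exists_comb_mem_of_finrank_le_succ K' E hle hcodim
      (hvM (Pi.single 0 1) a c) (hvM (Pi.single 1 1) a c)
    refine ⟨p • Pi.single 0 1 + q • Pi.single 1 1, fun h => ?_, ?_⟩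
    · have e0 := congr_fun h 0; have e1 := congr_fun h 1
      simp at e0 e1
      rcases hpq with hp | hq
      exacts [hp e0, hq e1]
    · rw [add_vecMulVec, smul_vecMulVec, smul_vecMulVec]; exact hK'K _ hmem
  -- a column-type plane `k² ⊗ v` in `K₀` is impossible (A)
  have plane : ∀ a c, (a ≠ 0 ∨ c ≠ 0) → vecMulVec (Pi.single 0 1) (vv a c) ∈ K₀ →
      vecMulVec (Pi.single 1 1) (vv a c) ∈ K₀ → False := by
    intro a c hac h0 h1
    refine no_columnPlane_of_forall_g_eq_zero β O hO hO' hcard (hvne a c hac) fun y t ht => ?_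
    have hy : vecMulVec y (vv a c) ∈ K₀ := by
      rw [eq_single_add_single y, add_vecMulVec, smul_vecMulVec, smul_vecMulVec]
      exact add_mem (K₀.smul_mem _ h0) (K₀.smul_mem _ h1)
    exact hK₀ _ hy t ht
  -- (D): `x ≠ 0` with `x ⊗ ρ₁, x ⊗ ρ₂ ∈ K₀` is impossible
  have hD : ∀ x : Fin 2 → k, x ≠ 0 → vecMulVec x (vv 1 0) ∈ K₀ → vecMulVec x (vv 0 1) ∈ K₀ → False := by
    intro x hx h10 h01
    have hxv : ∀ a c, vecMulVec x (vv a c) ∈ K₀ := fun a c => by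
      rw [hvlin a c, vecMulVec_add, vecMulVec_smul, vecMulVec_smul]
      exact add_mem (K₀.smul_mem _ h10) (K₀.smul_mem _ h01)
    by_cases hx1 : x 1 = 0
    · have hx0 : x 0 ≠ 0 := fun hx0 => hx (by funext r; fin_cases r; exacts [hx0, hx1])
      have he0 : (Pi.single 0 1 : Fin 2 → k) = (x 0)⁻¹ • x := by
        funext r; fin_cases r
        · simp [inv_mul_cancel₀ hx0]
        · simp [hx1]
      have h0 : ∀ a c, vecMulVec (Pi.single 0 1) (vv a c) ∈ K₀ := fun a c => by
        rw [he0, smul_vecMulVec]; exact K₀.smul_mem _ (hxv a c)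
      obtain ⟨p, q, hpq, hmem⟩ := exists_comb_mem_of_finrank_le_succ K' E hle hcodim
        (hvM (Pi.single 1 1) 1 0) (hvM (Pi.single 1 1) 0 1)
      have h1 : vecMulVec (Pi.single 1 1) (vv p q) ∈ K₀ := by
        rw [hvlin p q, vecMulVec_add, vecMulVec_smul, vecMulVec_smul]; exact hK'K _ hmem
      exact plane p q hpq (h0 p q) h1
    · obtain ⟨p, q, hpq, hmem⟩ := exists_comb_mem_of_finrank_le_succ K' E hle hcodim
        (hvM (Pi.single 0 1) 1 0) (hvM (Pi.single 0 1) 0 1)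
      have h0 : vecMulVec (Pi.single 0 1) (vv p q) ∈ K₀ := by
        rw [hvlin p q, vecMulVec_add, vecMulVec_smul, vecMulVec_smul]; exact hK'K _ hmem
      have he1 : (Pi.single 1 1 : Fin 2 → k) = (x 1)⁻¹ • (x - x 0 • (Pi.single 0 1 : Fin 2 → k)) := by
        funext r; fin_cases r
        · simp
        · simp [inv_mul_cancel₀ hx1]
      have h1 : vecMulVec (Pi.single 1 1) (vv p q) ∈ K₀ := by
        rw [he1, smul_vecMulVec, sub_vecMulVec, smul_vecMulVec]
        exact K₀.smul_mem _ (sub_mem (hxv p q) (K₀.smul_mem _ h0))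
      exact plane p q hpq h0 h1
  -- the three free directions `ρ₁`, `ρ₂`, `ρ₁ + ρ₂`
  obtain ⟨x₁, hx₁, hK₁⟩ := hH 1 0
  obtain ⟨x₂, hx₂, hK₂⟩ := hH 0 1
  obtain ⟨x₃, hx₃, hK₃⟩ := hH 1 1
  by_cases d12 : x₁ 0 * x₂ 1 - x₁ 1 * x₂ 0 = 0
  · obtain ⟨c, hc, hx⟩ := exists_smul_of_det_eq_zero hx₁ hx₂ d12
    rw [hx, smul_vecMulVec] at hK₂
    exact hD x₁ hx₁ hK₁ ((K₀.smul_mem_iff hc).mp hK₂)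
  by_cases d13 : x₁ 0 * x₃ 1 - x₁ 1 * x₃ 0 = 0
  · obtain ⟨c, hc, hx⟩ := exists_smul_of_det_eq_zero hx₁ hx₃ d13
    rw [hx, smul_vecMulVec] at hK₃
    have h3 : vecMulVec x₁ (vv 1 1) ∈ K₀ := (K₀.smul_mem_iff hc).mp hK₃
    have h2 : vecMulVec x₁ (vv 0 1) ∈ K₀ := by
      have : vecMulVec x₁ (vv 0 1) = vecMulVec x₁ (vv 1 1) - vecMulVec x₁ (vv 1 0) := by
        rw [← vecMulVec_sub, hv3, add_sub_cancel_left]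
      rw [this]; exact sub_mem h3 hK₁
    exact hD x₁ hx₁ hK₁ h2
  by_cases d23 : x₂ 0 * x₃ 1 - x₂ 1 * x₃ 0 = 0
  · obtain ⟨c, hc, hx⟩ := exists_smul_of_det_eq_zero hx₂ hx₃ d23
    rw [hx, smul_vecMulVec] at hK₃
    have h3 : vecMulVec x₂ (vv 1 1) ∈ K₀ := (K₀.smul_mem_iff hc).mp hK₃
    have h1 : vecMulVec x₂ (vv 1 0) ∈ K₀ := by
      have : vecMulVec x₂ (vv 1 0) = vecMulVec x₂ (vv 1 1) - vecMulVec x₂ (vv 0 1) := by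
        rw [← vecMulVec_sub, hv3, add_sub_cancel_right]
      rw [this]; exact sub_mem h3 hK₂
    exact hD x₂ hx₂ h1 hK₂
  -- generic case: pairwise independent ⇒ every `g_s`, `s ∈ O`, kills `e₀ ⊗ ρ₁`
  have hkill : ∀ s ∈ O, β.g s (vecMulVec (Pi.single 0 1) (vv 1 0)) = 0 := by
    intro s hs
    have lin : ∀ y : Fin 2 → k, β.g s (vecMulVec y (vv 1 1)) =
        β.g s (vecMulVec y (vv 1 0)) + β.g s (vecMulVec y (vv 0 1)) := fun y => by
      rw [hv3, vecMulVec_add, map_add]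
    rcases g_vanish_or_f_vanish β O hO hO' hcard hx₁ (hK₀ _ hK₁) hs with g1 | f1
    · exact g1 _
    rcases g_vanish_or_f_vanish β O hO hO' hcard hx₂ (hK₀ _ hK₂) hs with g2 | f2
    · rcases g_vanish_or_f_vanish β O hO hO' hcard hx₃ (hK₀ _ hK₃) hs with g3 | f3
      · have := lin (Pi.single 0 1)
        rw [g3, g2, add_zero] at this
        exact this.symm
      · exact (not_f_vanish_two_annihilators (β.f s) (hO' s hs) d13 f1 f3).elim
    · exact (not_f_vanish_two_annihilators (β.f s) (hO' s hs) d12 f1 f2).elim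
  have hzero : vecMulVec (Pi.single 0 1 : Fin 2 → k) (vv 1 0) = 0 := by
    have h := mul_eq_sum_off β 1 O hO (vecMulVec (Pi.single 0 1) (vv 1 0))
    rw [Matrix.one_mul] at h
    rw [h]
    exact Finset.sum_eq_zero fun s hs => by rw [hkill s hs, mul_zero, zero_smul]
  apply hρ₁
  funext j
  have := congr_fun (congr_fun hzero 0) j
  rw [vecMulVec_apply, Pi.single_eq_same, one_mul, Matrix.zero_apply] at this
  simpa [vv] using this

end DeltaLaw

end Summit.MatrixMultiplication.OmegaCensus.SmallFormats
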